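import Summits.ResolutionOfSingularities.ResolutionOfSingularities.Theorems.PurelyInseparableDim4IsolatedPowerIdeal
import Summits.ResolutionOfSingularities.ResolutionOfSingularities.Theorems.PurelyInseparableDim4ExceptionalLength
import HarnessLib
import HarnessLib.Audit.Tags

/-!
# Purely inseparable four-folds — (K-Φ1): isolation forbids `d`-fold contact with a prime lying in a HEAVY boundary
# component (cell `res-dim4-pi`, K2(p) lane, slice C residual B∞, res-dim4-idea-1 g5's Φ = β_h line, desk WORD #114 (a);
# seat res-dim4-p-11 g3 by idea-1 g5's signature sketch `lean-g5/Sketch.lean` 93ca6328f6e65aa1, stubs (1) and (2))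

[OURS · counted 0 · cell `res-dim4-pi`.]  Nothing here proves K2(p), `NoAboveFloorTrap p p` or resolution of
singularities in dimension ≥ 4 / characteristic `p`.  AI kernel work, weaker than expert review.

THE ONE NEW KERNEL SENTENCE of the Φ-line (idea-1 g5's (K-Φ1), «isolation half of CJS Lemma 13.4 (3)»): for a presented
state `F = x^r · G` that is an ISOLATED `p`-fold point and a boundary letter `h` with `r_h + d ≥ p`, the residual `G`
does not lie in `P^d` for any prime `P ⊊ 𝔪₀` containing `x_h` (`not_mem_pow_of_isIsolated`): otherwise
`F ∈ P^{r_h + d} ⊆ P^p`, every Hasse derivative of order `< p` of `F` lies in `P` (sharp Leibniz,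
`IsolatedBand.hasseDeriv_mem_pow_sub_of_mem_pow`), so `J_p⁺(F) ≤ P` has a minimal prime below `P ≠ 𝔪₀`.  The linear-frame
form with `P = (ℓ₁, ℓ₂, x_h)` (three elements of `𝔪₀`, no primality or independence needed) is K1
`IsolatedBand.not_isIsolated_of_unit_mul_mem_span_triple_pow` (`not_mem_linePow_of_isIsolated`).
[cite: CossartJannsenSaito2020, Lemma 13.4 (3)] [folklore]
bears_on: LADDER-RESOLUTION:D157-DOOR2 (res-dim4-pi · K2(p) · slice C residual · Φ-line (K-Φ1)).  Supports
stmt-ResolutionOfSingularities-16155 (helper).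
-/

set_option linter.dupNamespace false -- mandated namespace of this single-conjunct summit

noncomputable section

namespace Summit.ResolutionOfSingularities.ResolutionOfSingularities.Theorems.PIDim4

namespace PhiLine

open MvPolynomial Finset
open Literature.AlgebraicGeometry.Resolution

variable {K : Type} [Field K]

/-- `x^r = x_h^{r_h} · x^{r − r_h e_h}`, so `x^r ∈ P^{r_h}` whenever `x_h ∈ P`. [folklore] -/
theorem monomial_mem_pow_of_X_mem {P : Ideal (MvPolynomial (Fin 4) K)} {h : Fin 4}
    (hh : (X h : MvPolynomial (Fin 4) K) ∈ P) (r : Fin 4 →₀ ℕ) : monomial r (1 : K) ∈ P ^ (r h) := by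
  classical
  have hr : r = Finsupp.single h (r h) + (r - Finsupp.single h (r h)) := by
    ext i
    rw [Finsupp.add_apply, Finsupp.tsub_apply, Finsupp.single_apply]
    split_ifs with hi
    · subst hi; omega
    · omega
  have hsplit : monomial r (1 : K) = X h ^ (r h) * monomial (r - Finsupp.single h (r h)) (1 : K) := by
    rw [X_pow_eq_monomial, monomial_mul, one_mul, ← hr]
  rw [hsplit]
  exact Ideal.mul_mem_right _ _ (Ideal.pow_mem_pow hh _)

/-- `F = x^r · G ∈ P^{r_h + d}` when `x_h ∈ P` and `G ∈ P^d`. [folklore] -/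
theorem monomial_mul_mem_pow_add {P : Ideal (MvPolynomial (Fin 4) K)} {h : Fin 4}
    (hh : (X h : MvPolynomial (Fin 4) K) ∈ P) (r : Fin 4 →₀ ℕ) {G : MvPolynomial (Fin 4) K} {d : ℕ}
    (hG : G ∈ P ^ d) : monomial r (1 : K) * G ∈ P ^ (r h + d) := by
  rw [pow_add]
  exact Ideal.mul_mem_mul (monomial_mem_pow_of_X_mem hh r) hG

/-- If `F ∈ P^n` with `p ≤ n` then the `p`-fold locus ideal `J_p⁺(F)` lies in `P` (every Hasse derivative of order
`< p` of `F` stays in `P^{n − |α|} ⊆ P`). [cite: CossartJannsenSaito2020, Lemma 13.4 (3)] [folklore] -/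
theorem singLocusIdeal_le_of_mem_pow {p n : ℕ} (hpn : p ≤ n) {P : Ideal (MvPolynomial (Fin 4) K)}
    {F : MvPolynomial (Fin 4) K} (hF : F ∈ P ^ n) : singLocusIdeal p F ≤ P := by
  unfold singLocusIdeal
  rw [Ideal.span_le]
  rintro G ⟨α, h0, hα, rfl⟩
  have hmem := IsolatedBand.hasseDeriv_mem_pow_sub_of_mem_pow P n α (by omega) F hF
  have hle : P ^ (n - α.degree) ≤ P := Ideal.pow_le_self (by omega)
  exact hle hmem

/-- **(K-Φ1) ISOLATION FORBIDS `d`-FOLD CONTACT WITH A PRIME INSIDE A HEAVY BOUNDARY COMPONENT.**  For a presented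
state `F = x^r · G` that is an isolated `p`-fold point, a prime `P ⊊ 𝔪₀` containing the boundary letter `x_h`, and
`r_h + d ≥ p`: `G ∉ P^d`.  (idea-1 g5's stub (1), signature verbatim.) [cite: CossartJannsenSaito2020, Lemma 13.4 (3)]
[folklore] -/
theorem not_mem_pow_of_isIsolated {p d : ℕ} {F G : MvPolynomial (Fin 4) K} {r : Fin 4 →₀ ℕ}
    (hF : F = monomial r 1 * G) (hiso : IsIsolated p F) {P : Ideal (MvPolynomial (Fin 4) K)} (hP : P.IsPrime)
    (hPo : P ≤ originIdeal K) (hPne : P ≠ originIdeal K) {h : Fin 4} (hh : (X h : MvPolynomial (Fin 4) K) ∈ P)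
    (hd : p ≤ r h + d) : G ∉ P ^ d := by
  intro hG
  have hJ : singLocusIdeal p F ≤ P :=
    singLocusIdeal_le_of_mem_pow hd (by rw [hF]; exact monomial_mul_mem_pow_add hh r hG)
  haveI := hP
  obtain ⟨Q, hQ, hQP⟩ := Ideal.exists_minimalPrimes_le hJ
  have hQo : Q = originIdeal K := hiso.2 Q hQ (hQP.trans hPo)
  exact hPne (le_antisymm hPo (hQo ▸ hQP))

/-- A homogeneous polynomial of degree `1` vanishes at the origin. [folklore] -/
theorem mem_originIdeal_of_isHomogeneous_one {ℓ : MvPolynomial (Fin 4) K} (hℓ : ℓ.IsHomogeneous 1) :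
    ℓ ∈ originIdeal K := by
  refine ExceptionalLength.mem_originIdeal_of_constantCoeff_eq_zero ?_
  show coeff 0 ℓ = 0
  exact hℓ.coeff_eq_zero (by rw [map_zero]; exact zero_ne_one)

/-- **(K-Φ1), linear-frame form**: for ANY two linear forms `ℓ₁, ℓ₂` the residual `G` of an isolated state is not in
`(ℓ₁, ℓ₂, x_h)^d` once `r_h + d ≥ p` — three elements of `𝔪₀` (K1 `IsolatedBand.not_isIsolated_of_unit_mul_mem_span_triple_pow`,
no primality or independence needed). (idea-1 g5's stub (2), signature verbatim.)
[cite: CossartJannsenSaito2020, Lemma 13.4 (3)] [folklore] -/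
theorem not_mem_linePow_of_isIsolated {p d : ℕ} {F G : MvPolynomial (Fin 4) K} {r : Fin 4 →₀ ℕ}
    (hF : F = monomial r 1 * G) (hiso : IsIsolated p F) {h : Fin 4} (hd : p ≤ r h + d)
    (ℓ₁ ℓ₂ : MvPolynomial (Fin 4) K) (hℓ₁ : ℓ₁.IsHomogeneous 1) (hℓ₂ : ℓ₂.IsHomogeneous 1) :
    G ∉ (Ideal.span {ℓ₁, ℓ₂, (X h : MvPolynomial (Fin 4) K)}) ^ d := by
  intro hG
  have hXh : (X h : MvPolynomial (Fin 4) K) ∈ Ideal.span {ℓ₁, ℓ₂, (X h : MvPolynomial (Fin 4) K)} :=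
    Ideal.subset_span (by simp)
  have hFmem : (1 : MvPolynomial (Fin 4) K) * F ∈ (Ideal.span {ℓ₁, ℓ₂, (X h : MvPolynomial (Fin 4) K)}) ^ p := by
    rw [one_mul, hF]
    exact Ideal.pow_le_pow_right hd (monomial_mul_mem_pow_add hXh r hG)
  exact IsolatedBand.not_isIsolated_of_unit_mul_mem_span_triple_pow (by rw [map_one]; exact one_ne_zero)
    (mem_originIdeal_of_isHomogeneous_one hℓ₁) (mem_originIdeal_of_isHomogeneous_one hℓ₂)
    (ExceptionalLength.mem_originIdeal_of_constantCoeff_eq_zero (constantCoeff_X (R := K) h)) hFmem hiso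

end PhiLine

end Summit.ResolutionOfSingularities.ResolutionOfSingularities.Theorems.PIDim4

end
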